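import Summits.RiemannHypothesis.RiemannHypothesis.Theorems.GroundBartaPolarPerronFrobeniusRobustFloor
import HarnessLib

/-!
# The robust floor: explicit smallness of the leakage threshold, and the MASS FORM of the robust
crux (route `RiemannHypothesis/GroundBarta`, crux `PolarPerronFrobenius` stmt-RiemannHypothesis-18390;
helper / restatement candidate — RH-free)

File `…RobustFloor` floors the ground energy at windows carrying a ground state `u` with
(H0) `Im u = 0` a.e. on `(-a,a)`, (H1) `∫ v⁻Φ ≤ (1/3)∫ v⁺Φ` and (H2) `R_a(v⁻) ≤ (1/3) e(a) ∫ v⁺Φ`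
(`v = 𝟙_{(-a,a)}Re u`, `R_a(w) = Π_a∫w + Φ(a)(4√∫w² + 8∫w)`).  Here (H2) is traded for a bare
LOWER BOUND ON THE POSITIVE Φ-MASS with a universal, super-exponentially generous threshold:

* `thr_rate_lower` — `e(a) ≥ (2c₀/C₀)e^{-4π} e^{-2a}` for `a ≥ 1` (`c₀ = 2π² − 3π`, `C₀ = phiUpper`);
* `thr_primeMajorant_le` — `Π_a ≤ 2(C₀/c₀) S₁ Φ(a) e^{2a}`, `S₁ = Σ Λ(n) n^{-3/2}`
  (`Φ(m) ≤ (C₀/c₀) e^{-(m-a)} Φ(a)` for `m ≥ a ≥ 1`, `thr_phi_ratio`);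
* `thr_threshold_eventually` — there is `a₁` with
  `3(Π_a√(2a) + Φ(a)(4 + 8√(2a))) ≤ e(a)·exp(−e^{a})` for all `a ≥ a₁`;
* `riemannHypothesis_of_cofinal_signDominantGroundState` — **if beyond every height some window `a`
  carries a ground state `u` with (H0), (H1) and `∫ v⁺Φ ≥ exp(−e^{a})`, then RH**; and the route-shaped
  form `riemannHypothesis_of_signDominantPolarPerronFrobenius` (the same at even-winning windows,
  plus `EvenWinsBeyondArch`).  Since `√∫(v⁻)² ≤ ‖u‖₂ = 1` and `∫v⁻ ≤ √(2a)`, (H2) follows from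
  `∫ v⁺Φ ≥ exp(−e^{a})` beyond `a₁`.
So the RH-bearing residue of the robust route mentions Riemann's kernel `Φ` only through the two
moments `∫ (Re u)^±Φ`: Φ-WEIGHTED SIGN DOMINANCE of some ground state, cofinally.  RH-free; Mathlib +
landed tree files; no definitions.  References: Bombieri 2000 §4; Barta 1937 (López-Gómez p.175).
-/

set_option linter.dupNamespace false

noncomputable section

open Set MeasureTheory Filter Complex
open scoped Real Topology ComplexConjugate ArithmeticFunction.vonMangoldt

namespace Summit.RiemannHypothesis.RiemannHypothesis.Theorems.GroundBartaFloor

open Literature.NumberTheory.LFunctions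
open Summit.RiemannHypothesis.RiemannHypothesis.Theorems.GroundStatesConvergeToXi

/-! ## Constants -/

/-- `c₀ = 2π² − 3π > 0`. [folklore] -/
theorem thr_c0_pos : 0 < 2 * π ^ 2 - 3 * π := by nlinarith [Real.pi_gt_three]

/-! ## A lower bound for the Barta rate -/

/-- **Lower bound of the polar weight**: `ϖ_a ≥ 2c₀ e^{-2a} e^{9a/2 − πe^{2a} − 4π}` for `a ≥ 1`
(integrate the first-theta-term lower bound of `Φ` over `[a, a + e^{-2a}]`, where
`πe^{2s} ≤ πe^{2a} + 4π`). [folklore] -/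
theorem thr_polarWeight_lower {a : ℝ} (ha : 1 ≤ a) :
    2 * (2 * π ^ 2 - 3 * π) * Real.exp (-(2 * a)) *
        Real.exp (9 / 2 * a - π * Real.exp (2 * a) - 4 * π) ≤ groundThetaPolarWeight a := by
  have hc0 := thr_c0_pos
  set δ : ℝ := Real.exp (-(2 * a)) with hδ
  have hδ0 : 0 < δ := Real.exp_pos _
  have hδ1 : 2 * δ ≤ 1 := by
    have h1 : Real.exp (-(2 * a)) ≤ Real.exp (-2) := Real.exp_le_exp.2 (by linarith)
    have h2 : Real.exp (-2 : ℝ) ≤ 1 / 2 := by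
      have h3 : (1 : ℝ) + 2 ≤ Real.exp 2 := by linarith [Real.add_one_le_exp (2 : ℝ)]
      rw [Real.exp_neg, ← one_div]
      exact one_div_le_one_div_of_le (by norm_num) (by linarith)
    linarith
  set m : ℝ := 2 * (2 * π ^ 2 - 3 * π) * Real.exp (9 / 2 * a - π * Real.exp (2 * a) - 4 * π)
    with hm
  have hm0 : 0 ≤ m := by positivity
  -- pointwise lower bound on `[a, a + δ]`
  have hpt : ∀ s ∈ Ioc a (a + δ), m ≤ weilThetaPhi s * (2 * Real.cosh (s / 2)) := by
    intro s hs
    have hsa : a ≤ s := hs.1.le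
    have hs0 : 0 ≤ s := by linarith
    have hlow := rateDecay_phi_lower hs0
    have hx : |2 * (s - a)| ≤ 1 := by
      rw [abs_of_nonneg (by linarith)]; linarith [hs.2]
    have hexp1 : Real.exp (2 * (s - a)) - 1 ≤ 4 * δ := by
      have h := Real.abs_exp_sub_one_le hx
      rw [abs_of_nonneg (show (0 : ℝ) ≤ 2 * (s - a) by linarith)] at h
      have : Real.exp (2 * (s - a)) - 1 ≤ |Real.exp (2 * (s - a)) - 1| := le_abs_self _
      linarith [hs.2]
    have hE : π * Real.exp (2 * s) ≤ π * Real.exp (2 * a) + 4 * π := by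
      have e1 : Real.exp (2 * s) = Real.exp (2 * a) * Real.exp (2 * (s - a)) := by
        rw [← Real.exp_add]; congr 1; ring
      have h2 : Real.exp (2 * a) * (Real.exp (2 * (s - a)) - 1) ≤ Real.exp (2 * a) * (4 * δ) :=
        mul_le_mul_of_nonneg_left hexp1 (Real.exp_pos _).le
      have h3 : Real.exp (2 * a) * δ = 1 := by
        rw [hδ, ← Real.exp_add, show 2 * a + -(2 * a) = 0 by ring, Real.exp_zero]
      have h4 : Real.exp (2 * s) ≤ Real.exp (2 * a) + 4 := by nlinarith
      nlinarith [Real.pi_pos]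
    have hexp : Real.exp (9 / 2 * a - π * Real.exp (2 * a) - 4 * π) ≤
        Real.exp (9 / 2 * s - π * Real.exp (2 * s)) := Real.exp_le_exp.2 (by nlinarith)
    have hcosh : 1 ≤ 2 * Real.cosh (s / 2) := by linarith [Real.one_le_cosh (s / 2)]
    calc m ≤ 2 * (2 * π ^ 2 - 3 * π) * Real.exp (9 / 2 * s - π * Real.exp (2 * s)) := by
          rw [hm]; exact mul_le_mul_of_nonneg_left hexp (by positivity)
      _ ≤ weilThetaPhi s := hlow
      _ = weilThetaPhi s * 1 := (mul_one _).symm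
      _ ≤ weilThetaPhi s * (2 * Real.cosh (s / 2)) :=
          mul_le_mul_of_nonneg_left hcosh (weilThetaPhi_pos s).le
  have hfi : Integrable fun s : ℝ => weilThetaPhi s * (2 * Real.cosh (s / 2)) :=
    leakSign_integrable_phi_mul_two_cosh
  have hnn : ∀ s, 0 ≤ weilThetaPhi s * (2 * Real.cosh (s / 2)) := fun s =>
    mul_nonneg (weilThetaPhi_pos s).le (mul_nonneg zero_le_two (Real.cosh_pos _).le)
  calc 2 * (2 * π ^ 2 - 3 * π) * Real.exp (-(2 * a)) *
        Real.exp (9 / 2 * a - π * Real.exp (2 * a) - 4 * π) = m * δ := by rw [hm, hδ]; ring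
    _ = ∫ _ in Ioc a (a + δ), m := by
        rw [setIntegral_const, Real.volume_real_Ioc_of_le (by linarith), smul_eq_mul]; ring
    _ ≤ ∫ s in Ioc a (a + δ), weilThetaPhi s * (2 * Real.cosh (s / 2)) :=
        setIntegral_mono_on (integrableOn_const (measure_Ioc_lt_top.ne)) hfi.integrableOn
          measurableSet_Ioc hpt
    _ ≤ ∫ s in Ioi a, weilThetaPhi s * (2 * Real.cosh (s / 2)) :=
        setIntegral_mono_set hfi.integrableOn (ae_of_all _ hnn) Ioc_subset_Ioi_self.eventuallyLE
    _ = groundThetaPolarWeight a := rfl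

/-- **Lower bound of the Barta rate**: `e(a) ≥ (2c₀/C₀) e^{-4π} e^{-2a}` for `a ≥ 1`. [folklore] -/
theorem thr_rate_lower {a : ℝ} (ha : 1 ≤ a) :
    2 * (2 * π ^ 2 - 3 * π) / phiUpper * Real.exp (-(4 * π)) * Real.exp (-(2 * a)) ≤
      groundBartaRate a := by
  have ha0 : 0 ≤ a := zero_le_one.trans ha
  have hc0 := thr_c0_pos
  have hC := phiUpper_pos
  have hΦ := weilThetaPhi_pos a
  have hup := rateDecay_phi_upper ha0
  have hϖ := thr_polarWeight_lower ha
  have hcosh : 1 ≤ Real.cosh (a / 2) := Real.one_le_cosh _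
  have hϖ0 := groundThetaPolarWeight_nonneg a
  have e9 : Real.exp (9 / 2 * a - π * Real.exp (2 * a) - 4 * π) =
      Real.exp (9 / 2 * a - π * Real.exp (2 * a)) * Real.exp (-(4 * π)) := by
    rw [show 9 / 2 * a - π * Real.exp (2 * a) - 4 * π =
      (9 / 2 * a - π * Real.exp (2 * a)) + -(4 * π) by ring, Real.exp_add]
  set E9 : ℝ := Real.exp (9 / 2 * a - π * Real.exp (2 * a)) with hE9
  set Em : ℝ := Real.exp (-(2 * a)) with hEm
  set E4 : ℝ := Real.exp (-(4 * π)) with hE4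
  have hE9 : 0 < E9 := Real.exp_pos _
  unfold groundBartaRate
  rw [le_div_iff₀ hΦ]
  rw [e9] at hϖ
  calc 2 * (2 * π ^ 2 - 3 * π) / phiUpper * E4 * Em * weilThetaPhi a
      ≤ 2 * (2 * π ^ 2 - 3 * π) / phiUpper * E4 * Em * (2 * phiUpper * E9) :=
        mul_le_mul_of_nonneg_left hup (by positivity)
    _ = 2 * (2 * (2 * π ^ 2 - 3 * π) * Em * (E9 * E4)) * 1 := by field_simp
    _ ≤ 2 * groundThetaPolarWeight a * Real.cosh (a / 2) :=
        mul_le_mul (mul_le_mul_of_nonneg_left hϖ zero_le_two) hcosh zero_le_one (by positivity)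

/-! ## An upper bound for the prime majorant `Π_a` -/

/-- **Ratio bound for Riemann's kernel**: `Φ(m) ≤ (C₀/c₀) e^{-(m-a)} Φ(a)` for `1 ≤ a ≤ m`
(upper/lower theta bounds and `π(e^{2m} − e^{2a}) ≥ 2π(m − a) ≥ (11/2)(m − a)`). [folklore] -/
theorem thr_phi_ratio {a m : ℝ} (ha : 1 ≤ a) (ham : a ≤ m) :
    weilThetaPhi m ≤ phiUpper / (2 * π ^ 2 - 3 * π) * Real.exp (-(m - a)) * weilThetaPhi a := by
  have ha0 : 0 ≤ a := zero_le_one.trans ha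
  have hm0 : 0 ≤ m := ha0.trans ham
  have hc0 := thr_c0_pos
  have hC := phiUpper_pos
  have hup := rateDecay_phi_upper hm0
  have hlow := rateDecay_phi_lower ha0
  have hconv : 2 * (m - a) ≤ Real.exp (2 * m) - Real.exp (2 * a) := by
    have h1 : 1 + 2 * (m - a) ≤ Real.exp (2 * (m - a)) := by
      linarith [Real.add_one_le_exp (2 * (m - a))]
    have h2 : Real.exp (2 * m) = Real.exp (2 * a) * Real.exp (2 * (m - a)) := by
      rw [← Real.exp_add]; congr 1; ring
    have h3 : (1 : ℝ) ≤ Real.exp (2 * a) := Real.one_le_exp (by linarith)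
    rw [h2]
    nlinarith [Real.exp_pos (2 * (m - a))]
  have hexp : Real.exp (9 / 2 * m - π * Real.exp (2 * m)) ≤
      Real.exp (-(m - a)) * Real.exp (9 / 2 * a - π * Real.exp (2 * a)) := by
    rw [← Real.exp_add]
    exact Real.exp_le_exp.2 (by nlinarith [Real.pi_gt_three])
  calc weilThetaPhi m ≤ 2 * phiUpper * Real.exp (9 / 2 * m - π * Real.exp (2 * m)) := hup
    _ ≤ 2 * phiUpper * (Real.exp (-(m - a)) * Real.exp (9 / 2 * a - π * Real.exp (2 * a))) :=
        mul_le_mul_of_nonneg_left hexp (by positivity)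
    _ = phiUpper / (2 * π ^ 2 - 3 * π) * Real.exp (-(m - a)) *
          (2 * (2 * π ^ 2 - 3 * π) * Real.exp (9 / 2 * a - π * Real.exp (2 * a))) := by
        have hc0' : (2 * π ^ 2 - 3 * π) ≠ 0 := ne_of_gt hc0
        have e : phiUpper / (2 * π ^ 2 - 3 * π) * Real.exp (-(m - a)) *
            (2 * (2 * π ^ 2 - 3 * π) * Real.exp (9 / 2 * a - π * Real.exp (2 * a))) =
            2 * phiUpper * (Real.exp (-(m - a)) * Real.exp (9 / 2 * a - π * Real.exp (2 * a))) *
              ((2 * π ^ 2 - 3 * π) / (2 * π ^ 2 - 3 * π)) := by ring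
        rw [e, div_self hc0', mul_one]
    _ ≤ phiUpper / (2 * π ^ 2 - 3 * π) * Real.exp (-(m - a)) * weilThetaPhi a :=
        mul_le_mul_of_nonneg_left hlow (by positivity)

/-- **The prime majorant is `O(Φ(a) e^{2a})`**: `Π_a ≤ 2(C₀/c₀) S₁ Φ(a) e^{2a}` for `a ≥ 1`, with
`S₁ = Σ' Λ(n) n^{-1/2} e^{-log n}` (`= Σ Λ(n) n^{-3/2}`). [folklore] -/
theorem thr_primeMajorant_le {a : ℝ} (ha : 1 ≤ a) :
    2 * ∑' n : ℕ, (Λ n : ℝ) / Real.sqrt n * weilThetaPhi (max a (Real.log n - a)) ≤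
      2 * (phiUpper / (2 * π ^ 2 - 3 * π) * weilThetaPhi a * Real.exp (2 * a)) *
        ∑' n : ℕ, (Λ n : ℝ) / Real.sqrt n * Real.exp (-(1 * Real.log n)) := by
  have hc0 := thr_c0_pos
  have hC := phiUpper_pos
  have hΦ := weilThetaPhi_pos a
  set K : ℝ := phiUpper / (2 * π ^ 2 - 3 * π) * weilThetaPhi a * Real.exp (2 * a) with hK
  have hK0 : 0 ≤ K := by positivity
  have hs₁ := uniformBound_summable_vonMangoldt (b := 1) (by norm_num)
  have hle : ∀ n : ℕ, (Λ n : ℝ) / Real.sqrt n * weilThetaPhi (max a (Real.log n - a)) ≤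
      K * ((Λ n : ℝ) / Real.sqrt n * Real.exp (-(1 * Real.log n))) := by
    intro n
    have h1 := thr_phi_ratio ha (le_max_left a (Real.log n - a))
    have h2 : Real.exp (-(max a (Real.log n - a) - a)) ≤
        Real.exp (2 * a) * Real.exp (-(1 * Real.log n)) := by
      rw [← Real.exp_add]
      refine Real.exp_le_exp.2 ?_
      have := le_max_right a (Real.log n - a)
      linarith
    have h3 : weilThetaPhi (max a (Real.log n - a)) ≤ K * Real.exp (-(1 * Real.log n)) := by
      refine h1.trans ?_
      rw [hK]
      have := mul_le_mul_of_nonneg_left h2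
        (show 0 ≤ phiUpper / (2 * π ^ 2 - 3 * π) * weilThetaPhi a by positivity)
      nlinarith [this]
    calc (Λ n : ℝ) / Real.sqrt n * weilThetaPhi (max a (Real.log n - a))
        ≤ (Λ n : ℝ) / Real.sqrt n * (K * Real.exp (-(1 * Real.log n))) :=
          mul_le_mul_of_nonneg_left h3
            (div_nonneg ArithmeticFunction.vonMangoldt_nonneg (Real.sqrt_nonneg _))
      _ = K * ((Λ n : ℝ) / Real.sqrt n * Real.exp (-(1 * Real.log n))) := by ring
  have h := (leakNeg_summable_primeMajorant a).tsum_le_tsum hle (hs₁.mul_left K)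
  rw [tsum_mul_left] at h
  linarith

/-! ## The threshold is eventually below `e(a) exp(−e^{a})` -/

set_option maxHeartbeats 400000 in
/-- **Smallness of the leakage threshold.**  There is `a₁` such that for all `a ≥ a₁`:
`3(Π_a √(2a) + Φ(a)(4 + 8√(2a))) ≤ e(a) · exp(−e^{a})` — the left side is `O(√a e^{2a}Φ(a))`,
`Φ(a) ≤ 2C₀e^{9a/2 − πe^{2a}}`, while `e(a) ≥ (2c₀/C₀)e^{−4π}e^{−2a}`. [folklore] -/
theorem thr_threshold_eventually :
    ∃ a₁ : ℝ, ∀ a : ℝ, a₁ ≤ a →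
      3 * ((2 * ∑' n : ℕ, (Λ n : ℝ) / Real.sqrt n * weilThetaPhi (max a (Real.log n - a))) *
            Real.sqrt (2 * a) + weilThetaPhi a * (4 + 8 * Real.sqrt (2 * a))) ≤
        groundBartaRate a * Real.exp (-Real.exp a) := by
  have hc0 := thr_c0_pos
  have hC := phiUpper_pos
  set c0 : ℝ := 2 * π ^ 2 - 3 * π with hc0def
  set S₁ : ℝ := ∑' n : ℕ, (Λ n : ℝ) / Real.sqrt n * Real.exp (-(1 * Real.log n)) with hS₁
  have hS₁0 : 0 ≤ S₁ := tsum_nonneg fun n => mul_nonneg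
    (div_nonneg ArithmeticFunction.vonMangoldt_nonneg (Real.sqrt_nonneg _)) (Real.exp_pos _).le
  -- constants: `Π_a ≤ K₁ Φ(a) e^{2a}`, `e(a) ≥ K₃ e^{-2a}`
  set K₁ : ℝ := 2 * (phiUpper / c0) * S₁ with hK₁
  set K₃ : ℝ := 2 * c0 / phiUpper * Real.exp (-(4 * π)) with hK₃
  have hK₁0 : 0 ≤ K₁ := by positivity
  have hK₃0 : 0 < K₃ := by positivity
  set K₆ : ℝ := K₁ + 12 with hK₆
  set K₇ : ℝ := K₃ / (6 * K₆ * phiUpper) with hK₇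
  have hK₇0 : 0 < K₇ := by positivity
  refine ⟨max 2 (-Real.log K₇), fun a ha => ?_⟩
  have ha2 : 2 ≤ a := (le_max_left _ _).trans ha
  have haK : -Real.log K₇ ≤ a := (le_max_right _ _).trans ha
  have ha1 : 1 ≤ a := by linarith
  have ha0 : 0 ≤ a := by linarith
  have hΦ := weilThetaPhi_pos a
  have hup := rateDecay_phi_upper ha0
  have hPiLe := thr_primeMajorant_le ha1
  have hrate := thr_rate_lower ha1
  -- elementary size facts at `a ≥ 2`
  have hE2 : (1 : ℝ) ≤ Real.exp (2 * a) := Real.one_le_exp (by linarith)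
  have hsq1 : 1 ≤ Real.sqrt (2 * a) := by
    rw [show (1 : ℝ) = Real.sqrt 1 by simp]; exact Real.sqrt_le_sqrt (by linarith)
  have hsq0 : 0 ≤ Real.sqrt (2 * a) := Real.sqrt_nonneg _
  have hsqE : Real.sqrt (2 * a) ≤ Real.exp a := by
    have h1 : 2 * a ≤ Real.exp (2 * a) := by linarith [Real.add_one_le_exp (2 * a)]
    have h2 : Real.exp (2 * a) = Real.exp a ^ 2 := by rw [← Real.exp_nat_mul]; ring_nf
    rw [h2] at h1
    exact (Real.sqrt_le_sqrt h1).trans (le_of_eq (Real.sqrt_sq (Real.exp_pos a).le))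
  have hx4 : 4 ≤ Real.exp a := by
    have h1 : (2 : ℝ) ≤ Real.exp 1 := by linarith [Real.add_one_le_exp (1 : ℝ)]
    have h2 : Real.exp 1 ^ 2 ≤ Real.exp a := by
      rw [← Real.exp_nat_mul]; exact Real.exp_le_exp.2 (by norm_num; linarith)
    nlinarith
  have hax : a ≤ Real.exp a := by linarith [Real.add_one_le_exp a]
  -- (1) the left side is `≤ 3 K₆ Φ(a) e^{2a} √(2a)`
  set Φa := weilThetaPhi a with hΦa
  set Pi_a : ℝ := 2 * ∑' n : ℕ, (Λ n : ℝ) / Real.sqrt n * weilThetaPhi (max a (Real.log n - a))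
    with hPi
  have hPi0 : 0 ≤ Pi_a := leakNeg_primeMajorant_nonneg a
  have hPi' : Pi_a ≤ K₁ * Φa * Real.exp (2 * a) := by
    have : Pi_a ≤ 2 * (phiUpper / c0 * Φa * Real.exp (2 * a)) * S₁ := hPiLe
    rw [hK₁]; linarith [this]
  have hL : Pi_a * Real.sqrt (2 * a) + Φa * (4 + 8 * Real.sqrt (2 * a)) ≤
      K₆ * Φa * Real.exp (2 * a) * Real.sqrt (2 * a) := by
    have h1 : Pi_a * Real.sqrt (2 * a) ≤ K₁ * Φa * Real.exp (2 * a) * Real.sqrt (2 * a) :=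
      mul_le_mul_of_nonneg_right hPi' hsq0
    have h2 : Φa * (4 + 8 * Real.sqrt (2 * a)) ≤ 12 * Φa * Real.exp (2 * a) * Real.sqrt (2 * a) := by
      have h3 : 4 + 8 * Real.sqrt (2 * a) ≤ 12 * (Real.exp (2 * a) * Real.sqrt (2 * a)) := by
        nlinarith
      nlinarith [hΦ]
    rw [hK₆]; linarith
  -- (2) `3 K₆ Φ(a) e^{2a} √(2a) ≤ 6 K₆ C₀ exp(15a/2 − πe^{2a})`
  have hexp15 : Real.exp (9 / 2 * a - π * Real.exp (2 * a)) * Real.exp (2 * a) * Real.exp a =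
      Real.exp (15 / 2 * a - π * Real.exp (2 * a)) := by
    rw [← Real.exp_add, ← Real.exp_add]; congr 1; ring
  have hL2 : K₆ * Φa * Real.exp (2 * a) * Real.sqrt (2 * a) ≤
      2 * K₆ * phiUpper * Real.exp (15 / 2 * a - π * Real.exp (2 * a)) := by
    have hK₆0 : 0 ≤ K₆ := by positivity
    calc K₆ * Φa * Real.exp (2 * a) * Real.sqrt (2 * a)
        ≤ K₆ * (2 * phiUpper * Real.exp (9 / 2 * a - π * Real.exp (2 * a))) *
            Real.exp (2 * a) * Real.exp a := by
          gcongr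
      _ = 2 * K₆ * phiUpper * (Real.exp (9 / 2 * a - π * Real.exp (2 * a)) *
            Real.exp (2 * a) * Real.exp a) := by ring
      _ = _ := by rw [hexp15]
  -- (3) the exponent: `15a/2 − πe^{2a} ≤ −2a − e^{a} + log K₇`
  have hexpo : 15 / 2 * a - π * Real.exp (2 * a) ≤ -(2 * a) - Real.exp a + Real.log K₇ := by
    have hsq : Real.exp (2 * a) = Real.exp a * Real.exp a := by rw [← Real.exp_add]; ring_nf
    have h1 : π * Real.exp (2 * a) ≥ 3 * (Real.exp a * Real.exp a) := by
      rw [hsq]; nlinarith [Real.pi_gt_three, Real.exp_pos a]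
    -- `x·x ≥ 4x` for `x = e^{a} ≥ 4`, and `a ≤ x`
    have h2 : 4 * Real.exp a ≤ Real.exp a * Real.exp a :=
      mul_le_mul_of_nonneg_right hx4 (Real.exp_pos a).le
    have h3 : -Real.log K₇ ≤ a := haK
    have h4 := (Real.exp_pos a).le
    linarith
  -- (4) assemble: LHS ≤ 6K₆C₀ exp(15a/2 − πe^{2a}) ≤ 6K₆C₀ K₇ e^{-2a} e^{-e^a} = K₃ e^{-2a} e^{-e^a} ≤ e(a) e^{-e^a}
  have hK₆pos : 0 < K₆ := by positivity
  have step : 3 * (Pi_a * Real.sqrt (2 * a) + Φa * (4 + 8 * Real.sqrt (2 * a))) ≤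
      6 * K₆ * phiUpper * Real.exp (15 / 2 * a - π * Real.exp (2 * a)) := by linarith [hL, hL2]
  have step2 : Real.exp (15 / 2 * a - π * Real.exp (2 * a)) ≤
      K₇ * (Real.exp (-(2 * a)) * Real.exp (-Real.exp a)) := by
    have e1 : K₇ * (Real.exp (-(2 * a)) * Real.exp (-Real.exp a)) =
        Real.exp (-(2 * a) - Real.exp a + Real.log K₇) := by
      rw [Real.exp_add, Real.exp_log hK₇0, ← Real.exp_add]; ring_nf
    rw [e1]
    exact Real.exp_le_exp.2 (by linarith)
  have step3 : 6 * K₆ * phiUpper * (K₇ * (Real.exp (-(2 * a)) * Real.exp (-Real.exp a))) =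
      K₃ * Real.exp (-(2 * a)) * Real.exp (-Real.exp a) := by
    rw [hK₇]; field_simp
  calc 3 * (Pi_a * Real.sqrt (2 * a) + Φa * (4 + 8 * Real.sqrt (2 * a)))
      ≤ 6 * K₆ * phiUpper * Real.exp (15 / 2 * a - π * Real.exp (2 * a)) := step
    _ ≤ 6 * K₆ * phiUpper * (K₇ * (Real.exp (-(2 * a)) * Real.exp (-Real.exp a))) :=
        mul_le_mul_of_nonneg_left step2 (by positivity)
    _ = K₃ * Real.exp (-(2 * a)) * Real.exp (-Real.exp a) := step3
    _ ≤ groundBartaRate a * Real.exp (-Real.exp a) :=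
        mul_le_mul_of_nonneg_right (by rw [hK₃, hc0def]; exact hrate) (Real.exp_pos _).le

end Summit.RiemannHypothesis.RiemannHypothesis.Theorems.GroundBartaFloor

end
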